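import Literature.ModelTheory.ExponentialFields.OEFDefinablyCompleteZeros
import Mathlib.Algebra.Polynomial.BigOperators
import HarnessLib

/-!
# `OEF ∪ [DC]` proves the uniform zero-bound axioms for one-variable exponential polynomials

Topic `Literature/ModelTheory/ExponentialFields`.  Berarducci–Servi's recursively axiomatized
o-minimal subtheory `T_omin ⊆ T_exp` (Ann. Pure Appl. Logic 125 (2004), Cor. 2.5) consists of
the sentences "for all parameters, `{x | φ(x, ȳ)}` is a union of at most `Γ(φ)` intervals and
points", justified there by their truth in `ℝ` (Khovanskii); on the Fornasiero–Servi /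
Jones–Servi route such uniform finiteness statements are instead *derived* from
`[OF] + [DC(B)] + [exp' = exp]` (Fund. Math. 209 (2010), Thm. 8.2, Cor. 8.3; J. Symbolic Logic
76 (2011), Def. 1.2).  This file writes down, as first-order sentences of `L_exp`, the uniform
zero bounds for one-variable exponential polynomials of `OEFDefinablyCompleteZeros.lean` and
proves them *in* the recursive theory `OEFDC = OEF ∪ [DC] ⊆ Th(ℝ_exp)`:

* `UnaryExpPoly.fTerm n d ā x` — the term `Σ_{j<n} (Σ_{i≤d} a_{j,i} xⁱ) · exp(x)ʲ`, with
  `UnaryExpPoly.realize_fTerm` (its value is `UnaryExpPoly.eval exp (coeffPoly n d ā) n x`);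
* **`zeroBoundSentence n d`** — "for all coefficients `ā`: if `F_ā` vanishes at
  `n(d+1) + 1` points `x₀ < x₁ < ⋯ < x_{n(d+1)}` then `F_ā` vanishes identically";
* **`OEFModel.realize_zeroBoundSentence`** — it holds in every definably complete model of
  `OEF` (by `OEFModel.finite_setOf_unaryExpPoly_eq_zero`: a nonzero `F_ā` has at most
  `Σ_j (deg P_j + 1) - 1 ≤ n(d+1) - 1` zeros), hence **`OEFDC_models_zeroBoundSentence`**:
  `OEFDC ⊨ zeroBoundSentence n d`, and `zeroBoundSentence_mem_realExpTheory`.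

Everything is proved; the definitions are the syntactic objects (`sumT`, `powT`, `fTerm`,
`coeffPoly`, `zeroBound`, the formulas and the sentence).

## References

* A. Berarducci, T. Servi, Ann. Pure Appl. Logic 125 (2004), Corollary 2.5. [BerarducciServi2004]
* A. Fornasiero, T. Servi, Fund. Math. 209 (2010), Theorem 8.2, Corollary 8.3, Theorem 8.4.
  [FornasieroServi2010]
* G. O. Jones, T. Servi, J. Symbolic Logic 76 (2011), Def. 1.2, Prop. 3.1. [JonesServi2011]
-/

noncomputable section

open Set FirstOrder FirstOrder.Language FirstOrder.Language.Structure Polynomial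
open scoped FirstOrder

namespace Literature.ModelTheory.ExponentialFields

universe w

namespace UnaryExpPoly

variable {γ : Type*}

/-! ### Terms -/

/-- The iterated sum `t₀ + ⋯ + t_{m-1}` of a tuple of `L_exp`-terms (a syntactic helper, like
`ExpPolyCode.prodTerm` of `LastRootConjectureProofs.lean`). [folklore] -/
def sumT : {m : ℕ} → (Fin m → Language.orderedExpRing.Term γ) → Language.orderedExpRing.Term γ
  | 0, _ => 0
  | _ + 1, t => sumT (fun i => t i.castSucc) + t (Fin.last _)

/-- The power `tᵏ` of an `L_exp`-term (as `ExpPolyCode.powTerm`, kept here to avoid the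
analytic imports of that file). [folklore] -/
def powT (t : Language.orderedExpRing.Term γ) : ℕ → Language.orderedExpRing.Term γ
  | 0 => 1
  | k + 1 => powT t k * t

/-- **The one-variable exponential polynomial term** `Σ_{j<n} (Σ_{i≤d} a_{j,i} · xⁱ) · exp(x)ʲ`
with coefficient terms `a_{j,i}` and argument term `x`. [folklore] -/
def fTerm (n d : ℕ) (a : Fin n × Fin (d + 1) → Language.orderedExpRing.Term γ)
    (x : Language.orderedExpRing.Term γ) : Language.orderedExpRing.Term γ :=
  sumT fun j : Fin n => sumT (fun i : Fin (d + 1) => a (j, i) * powT x i) *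
    powT (Language.orderedExpRing.termExp x) j

/-- The coefficient polynomials `P_j = Σ_{i≤d} c_{j,i} Xⁱ` (`j < n`; `0` beyond) of a coefficient
assignment `c`. [folklore] -/
def coeffPoly {K : Type*} [Semiring K] (n d : ℕ) (c : Fin n × Fin (d + 1) → K) (j : ℕ) : K[X] :=
  if h : j < n then ∑ i : Fin (d + 1), C (c (⟨j, h⟩, i)) * X ^ (i : ℕ) else 0

/-- The uniform bound `n(d+1)` on the Rolle budget of such a family. [folklore] -/
def zeroBound (n d : ℕ) : ℕ := n * (d + 1)

/-- `deg P_j ≤ d`. [folklore] -/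
theorem natDegree_coeffPoly_le {K : Type*} [Semiring K] (n d : ℕ) (c : Fin n × Fin (d + 1) → K)
    (j : ℕ) : (coeffPoly n d c j).natDegree ≤ d := by
  unfold coeffPoly
  split_ifs with h
  · refine natDegree_sum_le_of_forall_le _ _ fun i _ => ?_
    exact (natDegree_C_mul_X_pow_le _ _).trans (Nat.lt_succ_iff.1 i.isLt)
  · simp

/-- **The budget of the family is at most `n(d+1)`.** [folklore] -/
theorem budget_coeffPoly_le {K : Type*} [Field K] (n d : ℕ) (c : Fin n × Fin (d + 1) → K) :
    budget (coeffPoly n d c) n ≤ zeroBound n d := by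
  unfold budget zeroBound
  calc ∑ j ∈ Finset.range n, termBudget (coeffPoly n d c j)
      ≤ ∑ _j ∈ Finset.range n, (d + 1) :=
        Finset.sum_le_sum fun j _ =>
          (termBudget_le _).trans (Nat.succ_le_succ (natDegree_coeffPoly_le n d c j))
    _ = n * (d + 1) := by rw [Finset.sum_const, Finset.card_range, smul_eq_mul]

/-- If all `P_j` vanish, so does every coefficient `c_{j,i}`-combination: the exponential
polynomial is identically zero. [folklore] -/
theorem eval_coeffPoly_eq_zero_of_forall {K : Type*} [Field K] {E : K → K} {n d : ℕ}
    {c : Fin n × Fin (d + 1) → K} (h : ∀ j < n, coeffPoly n d c j = 0) (x : K) :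
    eval E (coeffPoly n d c) n x = 0 :=
  Finset.sum_eq_zero fun j hj => by rw [h j (Finset.mem_range.1 hj), Polynomial.eval_zero, zero_mul]

/-! ### Their values in a model of `OEF` -/

section Realize

variable (K : Language.Theory.ModelType.{0, 0, w} Theory.OEF) (v : γ → K)

/-- Value of an iterated sum term. [folklore] -/
theorem realize_sumT : ∀ {m : ℕ} (t : Fin m → Language.orderedExpRing.Term γ),
    (sumT t).realize v = ∑ i, (t i).realize v
  | 0, t => by simp [sumT]
  | m + 1, t => by
    rw [sumT, OEFModel.realize_add, realize_sumT (fun i => t i.castSucc), Fin.sum_univ_castSucc]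

/-- Value of a power term. [folklore] -/
theorem realize_powT (t : Language.orderedExpRing.Term γ) :
    ∀ k : ℕ, (powT t k).realize v = t.realize v ^ k
  | 0 => by simp [powT]
  | k + 1 => by rw [powT, OEFModel.realize_mul, realize_powT t k, pow_succ]

/-- Value of a coefficient polynomial at an index `j < n`. [folklore] -/
theorem eval_coeffPoly (n d : ℕ) (c : Fin n × Fin (d + 1) → K) (j : Fin n) (x : K) :
    (coeffPoly n d c j).eval x = ∑ i : Fin (d + 1), c (j, i) * x ^ (i : ℕ) := by
  simp only [coeffPoly, j.isLt, dif_pos, Fin.eta, eval_finsetSum, eval_mul, eval_C, eval_pow,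
    eval_X]

/-- **The exponential polynomial term evaluates to `UnaryExpPoly.eval`** of its coefficient
polynomials. [folklore] -/
theorem realize_fTerm (n d : ℕ) (a : Fin n × Fin (d + 1) → Language.orderedExpRing.Term γ)
    (x : Language.orderedExpRing.Term γ) :
    (fTerm n d a x).realize v =
      eval OEFModel.exp (coeffPoly n d (fun c => (a c).realize v)) n (x.realize v) := by
  simp only [fTerm, realize_sumT, OEFModel.realize_mul, realize_powT, OEFModel.realize_termExp,
    eval]
  rw [← Fin.sum_univ_eq_sum_range]
  refine Finset.sum_congr rfl fun j _ => ?_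
  rw [eval_coeffPoly]

end Realize

/-! ### The sentences -/

/-- `x₀ < x₁ < ⋯ < x_B` are zeros of `F_ā` (`B = n(d+1)`): a formula in the coefficient
variables `ā` and the point variables `x̄`. [folklore] -/
def chainZerosFormula (n d : ℕ) :
    Language.orderedExpRing.Formula
      ((Empty ⊕ (Fin n × Fin (d + 1))) ⊕ Fin (zeroBound n d + 1)) :=
  let a : Fin n × Fin (d + 1) → Language.orderedExpRing.Term
      ((Empty ⊕ (Fin n × Fin (d + 1))) ⊕ Fin (zeroBound n d + 1)) :=
    fun c => var (Sum.inl (Sum.inr c))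
  let x : Fin (zeroBound n d + 1) → Language.orderedExpRing.Term
      ((Empty ⊕ (Fin n × Fin (d + 1))) ⊕ Fin (zeroBound n d + 1)) :=
    fun i => var (Sum.inr i)
  (Formula.iInf fun i : Fin (zeroBound n d) =>
      ((x i.castSucc).relabel Sum.inl).lt ((x i.succ).relabel Sum.inl)) ⊓
    (Formula.iInf fun i : Fin (zeroBound n d + 1) => Term.equal (fTerm n d a (x i)) 0)

/-- `F_ā(y) = 0`: a formula in the coefficient variables `ā` and the variable `y`. [folklore] -/
def vanishesFormula (n d : ℕ) :
    Language.orderedExpRing.Formula ((Empty ⊕ (Fin n × Fin (d + 1))) ⊕ Unit) :=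
  Term.equal (fTerm n d (fun c => var (Sum.inl (Sum.inr c))) (var (Sum.inr ()))) 0

/-- **The uniform zero-bound sentence** `ZB_{n,d}`: "for all `ā`, if `F_ā = Σ_{j<n} (Σ_{i≤d}
a_{j,i} xⁱ) exp(x)ʲ` vanishes at `n(d+1) + 1` points `x₀ < ⋯ < x_{n(d+1)}` then `F_ā` vanishes
everywhere" — an instance of the uniform finiteness axioms of Berarducci–Servi's `T_omin`
(2004, Cor. 2.5). [cite: BerarducciServi2004, Corollary 2.5] -/
def zeroBoundSentence (n d : ℕ) : Language.orderedExpRing.Sentence :=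
  Formula.iAlls (Fin n × Fin (d + 1))
    ((Formula.iExs (Fin (zeroBound n d + 1)) (chainZerosFormula n d)).imp
      (Formula.iAlls Unit (vanishesFormula n d)))

/-- **Semantics of `ZB_{n,d}` in a model of `OEF`.** [folklore] -/
theorem realize_zeroBoundSentence_iff (K : Language.Theory.ModelType.{0, 0, w} Theory.OEF)
    (n d : ℕ) :
    K ⊨ zeroBoundSentence n d ↔
      ∀ c : Fin n × Fin (d + 1) → K,
        (∃ xs : Fin (zeroBound n d + 1) → K,
            (∀ i : Fin (zeroBound n d), xs i.castSucc < xs i.succ) ∧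
              ∀ i, eval OEFModel.exp (coeffPoly n d c) n (xs i) = 0) →
          ∀ y : K, eval OEFModel.exp (coeffPoly n d c) n y = 0 := by
  simp only [zeroBoundSentence, chainZerosFormula, vanishesFormula, Sentence.Realize,
    Formula.realize_iAlls, Formula.realize_imp, Formula.realize_iExs, Formula.realize_inf,
    Formula.realize_iInf, Formula.realize_equal, realize_fTerm, Term.realize_var,
    Sum.elim_inl, Sum.elim_inr, OEFModel.realize_zero]
  refine forall_congr' fun c => ?_
  refine imp_congr ?_ ?_
  · refine exists_congr fun xs => and_congr ?_ Iff.rfl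
    refine forall_congr' fun i => ?_
    simp [Formula.Realize, Term.realize_lt]
  · exact ⟨fun h y => h fun _ => y, fun h u => h (u ())⟩

/-! ### `ZB_{n,d}` holds in the definably complete models of `OEF` -/

/-- **`ZB_{n,d}` holds in every definably complete model of `OEF`**: a nonzero `F_ā` has at
most `Σ_j (deg P_j + 1) - 1 ≤ n(d+1) - 1` zeros (`OEFModel.finite_setOf_unaryExpPoly_eq_zero`),
so `n(d+1) + 1` zeros force all `P_j = 0`. [cite: FornasieroServi2010, Theorem 8.4] -/
theorem _root_.Literature.ModelTheory.ExponentialFields.OEFModel.realize_zeroBoundSentence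
    (K : Language.Theory.ModelType.{0, 0, w} Theory.OEF)
    (hDC : Language.orderedExpRing.IsDefinablyComplete K) (n d : ℕ) :
    K ⊨ zeroBoundSentence n d := by
  rw [realize_zeroBoundSentence_iff]
  rintro c ⟨xs, hmono, hzero⟩ y
  by_cases hP : ∃ j < n, coeffPoly n d c j ≠ 0
  · exfalso
    obtain ⟨hfin, hcard⟩ := OEFModel.finite_setOf_unaryExpPoly_eq_zero K hDC _ n hP
    have hbud := budget_coeffPoly_le n d c
    have hsm : StrictMono xs := (Fin.strictMono_iff_lt_succ (f := xs)).2 hmono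
    -- the `n(d+1) + 1` points are distinct zeros
    have hsub : ((Finset.univ.image xs : Finset K) : Set K) ⊆
        {x : K | eval OEFModel.exp (coeffPoly n d c) n x = 0} := by
      intro x hx
      obtain ⟨i, -, rfl⟩ := Finset.mem_image.1 (Finset.mem_coe.1 hx)
      exact hzero i
    have hle := Set.ncard_le_ncard hsub hfin
    rw [Set.ncard_coe_finset, Finset.card_image_of_injective _ hsm.injective, Finset.card_univ,
      Fintype.card_fin] at hle
    have hpos : 0 < budget (coeffPoly n d c) n := by
      obtain ⟨j, hj, hPj⟩ := hP
      exact budget_pos hj hPj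
    omega
  · push Not at hP
    exact eval_coeffPoly_eq_zero_of_forall hP y

/-- **`OEFDC ⊨ ZB_{n,d}`**: the recursive subtheory `OEF ∪ [DC]` of `Th(ℝ_exp)` proves the
uniform zero bounds for one-variable exponential polynomials. [cite: FornasieroServi2010, Corollary 8.3] -/
theorem _root_.Literature.ModelTheory.ExponentialFields.OEFDC_models_zeroBoundSentence (n d : ℕ) :
    Theory.OEFDC ⊨ᵇ zeroBoundSentence n d := by
  rw [Theory.models_sentence_iff]
  intro M
  exact OEFModel.realize_zeroBoundSentence (OEFDCModel.toOEF M) (OEFDCModel.isDefinablyComplete M)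
    n d

/-- `ℝ_exp ⊨ ZB_{n,d}` (the real exponential field is a definably complete model of `OEF`).
[folklore] -/
theorem _root_.Literature.ModelTheory.ExponentialFields.Real.realize_zeroBoundSentence (n d : ℕ) :
    ℝ ⊨ zeroBoundSentence n d :=
  OEFModel.realize_zeroBoundSentence (Theory.ModelType.of Theory.OEF ℝ) real_isDefinablyComplete
    n d

/-- `ZB_{n,d} ∈ Th(ℝ_exp)`. [folklore] -/
theorem _root_.Literature.ModelTheory.ExponentialFields.zeroBoundSentence_mem_realExpTheory
    (n d : ℕ) : zeroBoundSentence n d ∈ realExpTheory :=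
  Language.mem_completeTheory.2 (Real.realize_zeroBoundSentence n d)

end UnaryExpPoly

end Literature.ModelTheory.ExponentialFields
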